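import Summits.CriticalPhenomena.PercolationContinuityZ3.Theorems.PercNearOneGluingNoHeavyLowerTailSahiGridPatternTwoLayerTop

/-!
# `NoHeavyLowerTail` (crux stmt-CriticalPhenomena-4575), Sahi programme: **TOP-SLICE DOMINANCE WHEN TWO OF THE THREE SETS MISS THE
# BOTTOM LEVEL, EVERY DIMENSION**

Support file (seat `prim-ineq-gen-4`, generation 11; `--supports stmt-CriticalPhenomena-4575`).  Pure proofs, no definitions, no `sorry`,
standard axioms.  Companion of `…SahiGridPatternTwoLayerTop` (machinery: `block_eq`, `sStarD_counting`, `nested_slack_nonneg`, fibre Kleitman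
`sum_ind_lat_le_td`, coefficientwise Harris `sum_ind3_totDist_le`).

THEOREM (`two_mul_sStarD_top_le_of_twoSets`): if the up-sets `A, B ⊆ [3]^{n+1}` contain no point on the bottom level of the last axis and
`C ⊆ [3]^{n+1}` is an ARBITRARY up-set, then `2 · sStarD A₂ B₂ C₂ ≤ sStarD A B C` — the factor-2 top-slice dominance (TOP) whenever two of the
three sets miss the bottom level, every dimension (memo `run/shared/lean/prim/prim-ineq-gen-4/FINDING-TOP-SLICE-DOMINANCE-g11.md` §2c(ii); first
found as a 14-column LP certificate, here with the human proof: `Φ = 2^{n+2}|A₁B₁C₁| − Σα_X − N(C₀;A₁,B₁) + (slacks ≥ 0)`, `α_X ≤ 2^n|A₁B₁C₁|`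
by coefficientwise Harris, `N(C₀;A₁,B₁) ≤ α_C`, fibre Kleitman at the `A₂`- and `B₂`-points).  Also `sum_lat_le_td_first` (the Latin count is
dominated by `N(U;V,W)` — Kleitman at the first point, via the involution `thirdPt q`).  It generalises `two_mul_sStarD_top_le_of_twoLayer`.
TOP is false for general three-layer triples from `n+1 = 5` on; together with `…TopOnlyTop` these are its proved faces. [this work]
-/

namespace Summit.CriticalPhenomena.PercolationContinuityZ3.Theorems.SahiGridPattern

open Finset SahiGrid3
open scoped BigOperators

variable {n : ℕ}

/-! ### Top-slice dominance when TWO of the three sets miss the bottom level (the third arbitrary) -/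

/-- `thirdPt q` is an involution of `[3]^n`. [this work] -/
theorem thirdPt_thirdPt (q r : Pd n) : thirdPt q (thirdPt q r) = r := by
  funext a; unfold thirdPt
  have key : ∀ x y : Fin 3, -(x + -(x + y)) = y := by decide
  exact key (q a) (r a)

/-- `q` differs in every axis from `thirdPt q r` iff it does from `r`. [this work] -/
theorem totDist_thirdPt_right (q r : Pd n) : TotDist q (thirdPt q r) = TotDist q r := by
  rw [Bool.eq_iff_iff, totDist_iff, totDist_iff]
  have key : ∀ x y : Fin 3, (x ≠ -(x + y)) ↔ (x ≠ y) := by decide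
  exact ⟨fun h a => (key (q a) (r a)).1 (h a), fun h a => (key (q a) (r a)).2 (h a)⟩

/-- Re-indexing a fibre sum through the involution `thirdPt q`. [this work] -/
theorem sum_comp_thirdPt (q : Pd n) (f : Pd n → ℤ) : (∑ r, f (thirdPt q r)) = ∑ r, f r :=
  Equiv.sum_comp (Function.Involutive.toPerm (thirdPt q) (thirdPt_thirdPt q)) f

/-- **The Latin count in first-point form is dominated by `N(U;V,W)`** (fibre Kleitman at the `U`-point): for up-sets `V, W` and any `U`,
`Σ_{q,r} 1_V(q)1_W(r)1_U(q̄r)[q δ̸ r] ≤ Σ_{p,q} 1_U(p)1_V(q)1_W(q)[p δ̸ q]`. [this work] -/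
theorem sum_lat_le_td_first (U : Finset (Pd n)) {V W : Finset (Pd n)} (hV : IsUpperSet (V : Set (Pd n))) (hW : IsUpperSet (W : Set (Pd n))) :
    (∑ q, ∑ r, ind V q * ind W r * ind U (thirdPt q r) * (if TotDist q r = true then (1:ℤ) else 0)) ≤
      ∑ p, ∑ q, ind U p * ind V q * ind W q * (if TotDist p q = true then (1:ℤ) else 0) := by
  -- re-index r ↦ thirdPt q r in the inner sum, then swap the two sums
  have e1 : (∑ q, ∑ r, ind V q * ind W r * ind U (thirdPt q r) * (if TotDist q r = true then (1:ℤ) else 0)) =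
      ∑ q, ∑ r, ind V q * ind W (thirdPt q r) * ind U r * (if TotDist q r = true then (1:ℤ) else 0) := by
    refine Finset.sum_congr rfl fun q _ => ?_
    rw [← sum_comp_thirdPt q (fun r => ind V q * ind W (thirdPt q r) * ind U r * (if TotDist q r = true then (1:ℤ) else 0))]
    refine Finset.sum_congr rfl fun r _ => ?_
    simp only [thirdPt_thirdPt, totDist_thirdPt_right]
  have e2 : (∑ q, ∑ r, ind V q * ind W (thirdPt q r) * ind U r * (if TotDist q r = true then (1:ℤ) else 0)) =
      ∑ r, ∑ q, ind U r * ind V q * ind W (thirdPt r q) * (if TotDist r q = true then (1:ℤ) else 0) := by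
    rw [Finset.sum_comm]
    refine Finset.sum_congr rfl fun r _ => Finset.sum_congr rfl fun q _ => ?_
    rw [thirdPt_comm q r, totDist_symm q r]; ring
  rw [e1, e2]
  exact sum_ind_lat_le_td U hV hW


/-- Values of the per-axis counts for first two levels in `{1,2}` and the third arbitrary (bookkeeping). [this work] -/
theorem c_vals_twoSets :
    c1 (1:Fin 3) 1 0 = 0 ∧ c1 (1:Fin 3) 2 0 = 0 ∧ c1 (2:Fin 3) 1 0 = 0 ∧ c1 (2:Fin 3) 2 0 = 0 ∧
    c2 (1:Fin 3) 1 0 = 0 ∧ c2 (1:Fin 3) 2 0 = 0 ∧ c2 (2:Fin 3) 1 0 = 0 ∧ c2 (2:Fin 3) 2 0 = 0 ∧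
    c2 (0:Fin 3) 1 1 = 1 ∧ c2 (0:Fin 3) 1 2 = 0 ∧ c2 (0:Fin 3) 2 1 = 0 ∧ c2 (0:Fin 3) 2 2 = 1 ∧
    c3 (1:Fin 3) 1 0 = 0 ∧ c3 (1:Fin 3) 2 0 = 1 ∧ c3 (2:Fin 3) 1 0 = 1 ∧ c3 (2:Fin 3) 2 0 = 0 := by
  unfold c1 c2 c3; decide

set_option maxHeartbeats 400000 in
/-- **TOP-SLICE DOMINANCE WHEN TWO SETS MISS THE BOTTOM LEVEL** (every `n`): if the up-sets `A, B ⊆ [3]^{n+1}` contain no point on the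
bottom level of the last axis and `C` is an ARBITRARY up-set, then `2 · sStarD A₂ B₂ C₂ ≤ sStarD A B C`.
Proof (memo §2c(ii), human form): `Φ = 2^{n+2}|uvw| − Σα_X − N(C₀;u,v) + [slacks ≥ 0]` with `α_X ≤ 2^n|uvw|` (coefficientwise Harris ×3) and
`N(C₀;u,v) ≤ N(C₁;u,v) = α_C`; fibre Kleitman twice. [this work] -/
theorem two_mul_sStarD_top_le_of_twoSets (A B C : Finset (Pd (n + 1)))
    (hA : IsUpperSet (A : Set (Pd (n + 1)))) (hB : IsUpperSet (B : Set (Pd (n + 1)))) (hC : IsUpperSet (C : Set (Pd (n + 1))))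
    (hA0 : ∀ q : Pd n, (Fin.snoc q 0 : Pd (n + 1)) ∉ A) (hB0 : ∀ q : Pd n, (Fin.snoc q 0 : Pd (n + 1)) ∉ B) :
    2 * sStarD (univ.filter fun q : Pd n => (Fin.snoc q 2 : Pd (n + 1)) ∈ A)
          (univ.filter fun q : Pd n => (Fin.snoc q 2 : Pd (n + 1)) ∈ B)
          (univ.filter fun q : Pd n => (Fin.snoc q 2 : Pd (n + 1)) ∈ C) ≤ sStarD A B C := by
  set U : Finset (Pd n) := univ.filter fun q : Pd n => (Fin.snoc q 2 : Pd (n + 1)) ∈ A with hUdef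
  set V : Finset (Pd n) := univ.filter fun q : Pd n => (Fin.snoc q 2 : Pd (n + 1)) ∈ B with hVdef
  set W : Finset (Pd n) := univ.filter fun q : Pd n => (Fin.snoc q 2 : Pd (n + 1)) ∈ C with hWdef
  set u : Finset (Pd n) := univ.filter fun q : Pd n => (Fin.snoc q 1 : Pd (n + 1)) ∈ A with hudef
  set v : Finset (Pd n) := univ.filter fun q : Pd n => (Fin.snoc q 1 : Pd (n + 1)) ∈ B with hvdef
  set w : Finset (Pd n) := univ.filter fun q : Pd n => (Fin.snoc q 1 : Pd (n + 1)) ∈ C with hwdef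
  set c : Finset (Pd n) := univ.filter fun q : Pd n => (Fin.snoc q 0 : Pd (n + 1)) ∈ C with hcdef
  have iU : ∀ p, ind A (Fin.snoc p 2) = ind U p := fun p => by rw [hUdef, ind_filter_snoc]
  have iV : ∀ p, ind B (Fin.snoc p 2) = ind V p := fun p => by rw [hVdef, ind_filter_snoc]
  have iW : ∀ p, ind C (Fin.snoc p 2) = ind W p := fun p => by rw [hWdef, ind_filter_snoc]
  have iu : ∀ p, ind A (Fin.snoc p 1) = ind u p := fun p => by rw [hudef, ind_filter_snoc]
  have iv : ∀ p, ind B (Fin.snoc p 1) = ind v p := fun p => by rw [hvdef, ind_filter_snoc]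
  have iw : ∀ p, ind C (Fin.snoc p 1) = ind w p := fun p => by rw [hwdef, ind_filter_snoc]
  have ic : ∀ p, ind C (Fin.snoc p 0) = ind c p := fun p => by rw [hcdef, ind_filter_snoc]
  have iA0 : ∀ p, ind A (Fin.snoc p 0) = 0 := fun p => by unfold ind; rw [if_neg (hA0 p)]
  have iB0 : ∀ p, ind B (Fin.snoc p 0) = 0 := fun p => by unfold ind; rw [if_neg (hB0 p)]
  have hUup : IsUpperSet (U : Set (Pd n)) := by rw [hUdef]; exact isUpperSet_filter_snoc hA 2
  have hVup : IsUpperSet (V : Set (Pd n)) := by rw [hVdef]; exact isUpperSet_filter_snoc hB 2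
  have hWup : IsUpperSet (W : Set (Pd n)) := by rw [hWdef]; exact isUpperSet_filter_snoc hC 2
  have huup : IsUpperSet (u : Set (Pd n)) := by rw [hudef]; exact isUpperSet_filter_snoc hA 1
  have hvup : IsUpperSet (v : Set (Pd n)) := by rw [hvdef]; exact isUpperSet_filter_snoc hB 1
  have hwup : IsUpperSet (w : Set (Pd n)) := by rw [hwdef]; exact isUpperSet_filter_snoc hC 1
  have nu : ∀ p, ind u p ≤ ind U p := fun p => by rw [← iu, ← iU]; exact ind_snoc_mono hA p (by decide)
  have nv : ∀ p, ind v p ≤ ind V p := fun p => by rw [← iv, ← iV]; exact ind_snoc_mono hB p (by decide)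
  have nw : ∀ p, ind w p ≤ ind W p := fun p => by rw [← iw, ← iW]; exact ind_snoc_mono hC p (by decide)
  have ncw : ∀ p, ind c p ≤ ind w p := fun p => by rw [← ic, ← iw]; exact ind_snoc_mono hC p (by decide)
  have ncW : ∀ p, ind c p ≤ ind W p := fun p => le_trans (ncw p) (nw p)
  -- the value of sStarD A B C: twelve level blocks
  have eA : sStarD A B C = 4 * 2 ^ n * (∑ p, ind u p * ind v p * ind w p) + 4 * 2 ^ n * (∑ p, ind U p * ind V p * ind W p)
      - (∑ p, ∑ q, ind u p * ind V q * ind W q * (if TotDist p q = true then (1:ℤ) else 0))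
      - (∑ p, ∑ q, ind U p * ind v q * ind w q * (if TotDist p q = true then (1:ℤ) else 0))
      - (∑ p, ∑ q, ind v p * ind U q * ind W q * (if TotDist p q = true then (1:ℤ) else 0))
      - (∑ p, ∑ q, ind V p * ind u q * ind w q * (if TotDist p q = true then (1:ℤ) else 0))
      - (∑ p, ∑ q, ind w p * ind U q * ind V q * (if TotDist p q = true then (1:ℤ) else 0))
      - (∑ p, ∑ q, ind W p * ind u q * ind v q * (if TotDist p q = true then (1:ℤ) else 0))
      - (∑ p, ∑ q, ind c p * ind U q * ind V q * (if TotDist p q = true then (1:ℤ) else 0))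
      - (∑ p, ∑ q, ind c p * ind u q * ind v q * (if TotDist p q = true then (1:ℤ) else 0))
      + (∑ q, ∑ r, ind V q * ind c r * ind u (thirdPt q r) * (if TotDist q r = true then (1:ℤ) else 0))
      + (∑ q, ∑ r, ind v q * ind c r * ind U (thirdPt q r) * (if TotDist q r = true then (1:ℤ) else 0)) := by
    rw [sStarD_eq_sum_ind]
    simp only [sum_snoc, Fin.sum_univ_three, iA0, iB0, iU, iV, iW, iu, iv, iw, ic, zero_mul, mul_zero,
      Finset.sum_const_zero, zero_add, Finset.sum_add_distrib]
    rw [block_eq, block_eq, block_eq, block_eq, block_eq, block_eq, block_eq, block_eq, block_eq, block_eq, block_eq, block_eq]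
    obtain ⟨a1, a2, a3, a4, a5, a6, a7, a8, b1, b2, b3, b4, b5, b6, b7, b8, d1, d2, d3, d4, d5, d6, d7, d8⟩ := c_vals_upper
    obtain ⟨g1, g2, g3, g4, h1, h2, h3, h4, k1, k2, k3, k4, l1, l2, l3, l4⟩ := c_vals_twoSets
    rw [a1, a2, a3, a4, a5, a6, a7, a8, b1, b2, b3, b4, b5, b6, b7, b8, d1, d2, d3, d4, d5, d6, d7, d8,
      g1, g2, g3, g4, h1, h2, h3, h4, k1, k2, k3, k4, l1, l2, l3, l4]
    ring
  have eT := sStarD_counting U V W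
  -- fibre Kleitman: at the U-point, and at the V-point
  have K0 := sum_lat_le_td_first U hVup hWup
  have K1 := sum_ind_lat_le_td V hWup hUup
  have K1' : (∑ q, ∑ r, ind V q * ind W r * ind U (thirdPt q r) * (if TotDist q r = true then (1:ℤ) else 0)) ≤
      ∑ p, ∑ q, ind V p * ind U q * ind W q * (if TotDist p q = true then (1:ℤ) else 0) := by
    refine le_trans K1 (le_of_eq ?_)
    refine Finset.sum_congr rfl fun p _ => Finset.sum_congr rfl fun q _ => ?_
    ring
  have K2 := sum_ind_lat_le_td W hVup hUup
  have K2' : (∑ q, ∑ r, ind V q * ind W r * ind U (thirdPt q r) * (if TotDist q r = true then (1:ℤ) else 0)) ≤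
      ∑ p, ∑ q, ind W p * ind U q * ind V q * (if TotDist p q = true then (1:ℤ) else 0) := by
    have e : (∑ q, ∑ r, ind V q * ind W r * ind U (thirdPt q r) * (if TotDist q r = true then (1:ℤ) else 0)) =
        ∑ p, ∑ q, ind W p * ind V q * ind U (thirdPt p q) * (if TotDist p q = true then (1:ℤ) else 0) := by
      rw [Finset.sum_comm]
      refine Finset.sum_congr rfl fun r _ => Finset.sum_congr rfl fun q _ => ?_
      rw [thirdPt_comm q r, totDist_symm q r]; ring
    rw [e]
    refine le_trans K2 (le_of_eq ?_)
    refine Finset.sum_congr rfl fun p _ => Finset.sum_congr rfl fun q _ => ?_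
    ring
  -- coefficientwise Harris, three times
  have HA := sum_ind3_totDist_le huup hvup hwup
  have HB' := sum_ind3_totDist_le hvup huup hwup
  have HB : (∑ p, ∑ q, ind v p * ind u q * ind w q * (if TotDist p q = true then (1:ℤ) else 0)) ≤
      2 ^ n * ∑ p, ind u p * ind v p * ind w p := by
    refine le_trans HB' (le_of_eq ?_); congr 1
    exact Finset.sum_congr rfl fun p _ => by ring
  have HC' := sum_ind3_totDist_le hwup huup hvup
  have HC : (∑ p, ∑ q, ind w p * ind u q * ind v q * (if TotDist p q = true then (1:ℤ) else 0)) ≤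
      2 ^ n * ∑ p, ind u p * ind v p * ind w p := by
    refine le_trans HC' (le_of_eq ?_); congr 1
    exact Finset.sum_congr rfl fun p _ => by ring
  -- bilinear slacks
  have dA := nested_slack_nonneg (U := U) (V := V) (W := W) nu nv nw
  have dB := nested_slack_nonneg (U := V) (V := U) (W := W) nv nu nw
  have dC := nested_slack_nonneg (U := W) (V := U) (W := V) nw nu nv
  -- the bottom slice of `C` is below its middle and top slices
  have Mc1 : (∑ p, ∑ q, ind c p * ind u q * ind v q * (if TotDist p q = true then (1:ℤ) else 0)) ≤
      ∑ p, ∑ q, ind w p * ind u q * ind v q * (if TotDist p q = true then (1:ℤ) else 0) := by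
    refine Finset.sum_le_sum fun p _ => Finset.sum_le_sum fun q _ => ?_
    have h0 : 0 ≤ ind u q * ind v q * (if TotDist p q = true then (1:ℤ) else 0) :=
      mul_nonneg (mul_nonneg (ind_nonneg' u q) (ind_nonneg' v q)) (by split_ifs <;> norm_num)
    nlinarith [ncw p, h0]
  have Mc2 : (∑ p, ∑ q, ind c p * ind U q * ind V q * (if TotDist p q = true then (1:ℤ) else 0)) ≤
      ∑ p, ∑ q, ind W p * ind U q * ind V q * (if TotDist p q = true then (1:ℤ) else 0) := by
    refine Finset.sum_le_sum fun p _ => Finset.sum_le_sum fun q _ => ?_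
    have h0 : 0 ≤ ind U q * ind V q * (if TotDist p q = true then (1:ℤ) else 0) :=
      mul_nonneg (mul_nonneg (ind_nonneg' U q) (ind_nonneg' V q)) (by split_ifs <;> norm_num)
    nlinarith [ncW p, h0]
  -- the two surviving Latin terms are nonnegative, and so is the top A-term
  have L1 : 0 ≤ ∑ q, ∑ r, ind V q * ind c r * ind u (thirdPt q r) * (if TotDist q r = true then (1:ℤ) else 0) :=
    Finset.sum_nonneg fun q _ => Finset.sum_nonneg fun r _ => mul_nonneg (mul_nonneg (mul_nonneg (ind_nonneg' V q) (ind_nonneg' c r))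
      (ind_nonneg' u _)) (by split_ifs <;> norm_num)
  have L2 : 0 ≤ ∑ q, ∑ r, ind v q * ind c r * ind U (thirdPt q r) * (if TotDist q r = true then (1:ℤ) else 0) :=
    Finset.sum_nonneg fun q _ => Finset.sum_nonneg fun r _ => mul_nonneg (mul_nonneg (mul_nonneg (ind_nonneg' v q) (ind_nonneg' c r))
      (ind_nonneg' U _)) (by split_ifs <;> norm_num)
  have TA : 0 ≤ ∑ p, ∑ q, ind U p * ind V q * ind W q * (if TotDist p q = true then (1:ℤ) else 0) :=
    Finset.sum_nonneg fun p _ => Finset.sum_nonneg fun q _ => mul_nonneg (mul_nonneg (mul_nonneg (ind_nonneg' U p) (ind_nonneg' V q))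
      (ind_nonneg' W q)) (by split_ifs <;> norm_num)
  rw [eT, eA]
  linarith


end Summit.CriticalPhenomena.PercolationContinuityZ3.Theorems.SahiGridPattern
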